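import Summits.CriticalPhenomena.PercolationContinuityZ3.Theorems.Transplant.Z3DiagonalGraph
import Mathlib.Tactic.FinCases
import HarnessLib

/-!
# The alternating-rung stacking of square lattices (square-pyramidal 5-coordination; the `sqp`-type net), I: the graph — `ℤ³` with every `e₁`- and
# `e₂`-bond and the `e₀`-bonds `{x, x + e₀}` for `x₀ + x₁ + x₂` even only — adjacency, local finiteness, automorphisms, transitivity

builds on p205010 (kernel theorem, internal audit signed; external expert review pending) — nothing in this file uses p205010.
Lane `prim-bschramm`, seat `prim-bschramm-p2` (gen 11; class C1b "other 3D lattices at their own critical points", METHOD = input substitution);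
helper file (`--supports stmt-CriticalPhenomena-4575 --as helper`).  Memo: `HOME/bschramm/P2-LATTICES.md` §35.  Pattern: `CdsNet` (same seat).

THE NET.  Vertices `ℤ³`; the planes `x₀ = c` are full square lattices (`±e₁`, `±e₂`); consecutive planes are joined by the RUNGS `{x, x + e₀}` with
`x₀ + x₁ + x₂` even — a perfect matching, so every vertex has exactly ONE rung (up on one checkerboard sublattice of its plane, down on the other):
5-valent, square-PYRAMIDAL coordination, obtained from the primitive cubic net by deleting one of the two `e₀`-bonds at every vertex in the
checkerboard fashion.  Vertex-transitive (translations of even coordinate sum + the parity-swapping reflection `x₀ ↦ −1 − x₀`); NOT a Cayley graph of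
`ℤ³` (odd valency), not a box product of infinite graphs, not `honeycomb □ ℤ` (no rung lies on a 4-cycle).  We call it the alternating-rung net
(`Sqp`; the uninodal square-pyramidal net of reticular chemistry as far as we can tell — the naming is for orientation only, every statement below is
about the graph defined here).  File II: the COORDINATE chart `φ = (x₁, x₂)` makes it a single-type `PlanarSkeletonSign` ⇒ `θ(p_c) = 0`.
* §1 `psum`, `rung`, `stepsAt`, **`Sqp.graph`**, `graph_adj_iff'`, adjacency introduction lemmas, degree `≤ 5`, local finiteness;
* §2 `isoOfMaps`, **`shift v` (`v₀+v₁+v₂` even), `swapIso` (`x₀ ↦ −1−x₀`), `negIso` (`(x₀,−x₁,−x₂)`), `flipZIso` (`(x₀,x₁,−x₂)`)**;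
* §3 `exists_iso_apply_zero`, **`graph_transitive`**, `graph_quasiTransitive`.
[cite: BenjaminiSchramm1996, §2 (quasi-transitive graphs), Conj. 4] [cite: GrimmettPercolation1999, §12.1 p. 349 (general lattices)]
-/

noncomputable section

namespace Summit.CriticalPhenomena.PercolationContinuityZ3.Theorems.Transplant

namespace Sqp

open Literature.Probability.Percolation Literature.Probability.LatticeModels SimpleGraph
open Literature.Barriers.CriticalPhenomena (IsQuasiTransitive IsGraphTransitive)
open Z3Diag (ev)
open scoped Classical

/-! ## §1 The graph -/

/-- The coordinate sum `x₀ + x₁ + x₂` (its parity decides the direction of the rung at `x`). [folklore] -/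
def psum (x : Site 3) : ℤ := x 0 + x 1 + x 2

/-- `psum` is additive. [folklore] -/
theorem psum_add (x y : Site 3) : psum (x + y) = psum x + psum y := by
  simp only [psum, Pi.add_apply]; ring

/-- `psum (−x) = −psum x`. [folklore] -/
theorem psum_neg (x : Site 3) : psum (-x) = -psum x := by
  simp only [psum, Pi.neg_apply]; ring

/-- `psum e₀ = psum e₁ = psum e₂ = 1`. [folklore] -/
theorem psum_ev (i : Fin 3) : psum (ev i) = 1 := by
  fin_cases i <;> simp [psum, ev]

/-- **The rung at `x`**: `+e₀` if `x₀ + x₁ + x₂` is even, `−e₀` if it is odd. [folklore] -/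
def rung (x : Site 3) : Site 3 := if Even (psum x) then ev 0 else -ev 0

/-- The rung on an even vertex. [folklore] -/
theorem rung_of_even {x : Site 3} (h : Even (psum x)) : rung x = ev 0 := by simp [rung, h]

/-- The rung on an odd vertex. [folklore] -/
theorem rung_of_not_even {x : Site 3} (h : ¬ Even (psum x)) : rung x = -ev 0 := by simp [rung, h]

/-- `rung` depends on the parity of `psum` only. [folklore] -/
theorem rung_congr {x y : Site 3} (h : Even (psum x) ↔ Even (psum y)) : rung x = rung y := by
  by_cases hx : Even (psum x)
  · rw [rung_of_even hx, rung_of_even (h.1 hx)]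
  · rw [rung_of_not_even hx, rung_of_not_even fun hy => hx (h.2 hy)]

/-- `psum (rung x) = ±1`, so the far end of the rung has the opposite parity. [folklore] -/
theorem even_psum_add_rung (x : Site 3) : Even (psum (x + rung x)) ↔ ¬ Even (psum x) := by
  by_cases hx : Even (psum x)
  · rw [rung_of_even hx, psum_add, psum_ev, Int.even_add_one]
  · rw [rung_of_not_even hx, psum_add, psum_neg, psum_ev, ← sub_eq_add_neg, Int.even_sub_one]

/-- The rung seen from its far end points back: `rung (x + rung x) = −rung x`. [folklore] -/
theorem rung_add_rung (x : Site 3) : rung (x + rung x) = -rung x := by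
  by_cases hx : Even (psum x)
  · rw [rung_of_not_even ((even_psum_add_rung x).not.2 (not_not.2 hx)), rung_of_even hx]
  · rw [rung_of_even ((even_psum_add_rung x).2 hx), rung_of_not_even hx, neg_neg]

/-- **The steps at `x`**: `±e₁`, `±e₂` and the rung. [folklore] -/
def stepsAt (x : Site 3) : Finset (Site 3) := {ev 1, -ev 1, ev 2, -ev 2, rung x}

/-- Membership in `stepsAt x`. [folklore] -/
theorem mem_stepsAt_iff {x s : Site 3} : s ∈ stepsAt x ↔ s = ev 1 ∨ s = -ev 1 ∨ s = ev 2 ∨ s = -ev 2 ∨ s = rung x := by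
  simp only [stepsAt, Finset.mem_insert, Finset.mem_singleton]

/-- `stepsAt` depends on the parity of `psum` only. [folklore] -/
theorem stepsAt_congr {x y : Site 3} (h : Even (psum x) ↔ Even (psum y)) : stepsAt x = stepsAt y := by
  rw [stepsAt, stepsAt, rung_congr h]

/-- `rung x ≠ 0`. [folklore] -/
theorem rung_ne_zero (x : Site 3) : rung x ≠ 0 := by
  intro h
  have h0 := congrFun h 0
  by_cases hx : Even (psum x)
  · rw [rung_of_even hx] at h0; simp [ev] at h0
  · rw [rung_of_not_even hx] at h0; simp [ev] at h0

/-- `0` is not a step. [folklore] -/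
theorem zero_notMem_stepsAt (x : Site 3) : (0 : Site 3) ∉ stepsAt x := by
  rw [mem_stepsAt_iff]
  push Not
  refine ⟨fun h => ?_, fun h => ?_, fun h => ?_, fun h => ?_, fun h => rung_ne_zero x h.symm⟩
  · have := congrFun h 1; simp [ev] at this
  · have := congrFun h 1; simp [ev] at this
  · have := congrFun h 2; simp [ev] at this
  · have := congrFun h 2; simp [ev] at this

/-- A step is symmetric: if `s` is a step at `x` then `−s` is a step at `x + s`. [folklore] -/
theorem neg_mem_stepsAt_add {x s : Site 3} (hs : s ∈ stepsAt x) : -s ∈ stepsAt (x + s) := by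
  rw [mem_stepsAt_iff] at hs ⊢
  rcases hs with rfl | rfl | rfl | rfl | rfl
  · exact Or.inr (Or.inl rfl)
  · rw [neg_neg]; exact Or.inl rfl
  · exact Or.inr (Or.inr (Or.inr (Or.inl rfl)))
  · rw [neg_neg]; exact Or.inr (Or.inr (Or.inl rfl))
  · exact Or.inr (Or.inr (Or.inr (Or.inr (rung_add_rung x).symm)))

/-- **The alternating-rung net**: `x ∼ y` iff `y − x` is a step at `x`. [cite: BenjaminiSchramm1996, §2] -/
def graph : SimpleGraph (Site 3) where
  Adj x y := y - x ∈ stepsAt x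
  symm := ⟨fun x y (h : y - x ∈ stepsAt x) => by
    show x - y ∈ stepsAt y
    have := neg_mem_stepsAt_add h
    rwa [neg_sub, add_sub_cancel] at this⟩
  loopless := ⟨fun x (h : x - x ∈ stepsAt x) => zero_notMem_stepsAt x (by rwa [sub_self] at h)⟩

/-- Adjacency: `y − x ∈ stepsAt x`. [folklore] -/
theorem graph_adj_iff (x y : Site 3) : graph.Adj x y ↔ y - x ∈ stepsAt x := Iff.rfl

/-- Adjacency is decidable. [folklore] -/
instance graph_decidableRel : DecidableRel graph.Adj := fun x y => decidable_of_iff _ (graph_adj_iff x y).symm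

/-- `x ∼ x + s` for every step `s` at `x`. [folklore] -/
theorem adj_add_of_mem {x s : Site 3} (hs : s ∈ stepsAt x) : graph.Adj x (x + s) := by
  rw [graph_adj_iff, add_sub_cancel_left]; exact hs

/-- `x ∼ x + e₁`. [folklore] -/
theorem adj_add_ev_one (x : Site 3) : graph.Adj x (x + ev 1) := adj_add_of_mem (mem_stepsAt_iff.2 (Or.inl rfl))

/-- `x ∼ x − e₁`. [folklore] -/
theorem adj_sub_ev_one (x : Site 3) : graph.Adj x (x - ev 1) := by
  rw [sub_eq_add_neg]; exact adj_add_of_mem (mem_stepsAt_iff.2 (Or.inr (Or.inl rfl)))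

/-- `x ∼ x + e₂`. [folklore] -/
theorem adj_add_ev_two (x : Site 3) : graph.Adj x (x + ev 2) := adj_add_of_mem (mem_stepsAt_iff.2 (Or.inr (Or.inr (Or.inl rfl))))

/-- `x ∼ x − e₂`. [folklore] -/
theorem adj_sub_ev_two (x : Site 3) : graph.Adj x (x - ev 2) := by
  rw [sub_eq_add_neg]; exact adj_add_of_mem (mem_stepsAt_iff.2 (Or.inr (Or.inr (Or.inr (Or.inl rfl)))))

/-- `x ∼ x + rung x`. [folklore] -/
theorem adj_add_rung (x : Site 3) : graph.Adj x (x + rung x) := adj_add_of_mem (mem_stepsAt_iff.2 (Or.inr (Or.inr (Or.inr (Or.inr rfl)))))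

/-- On an even vertex `x ∼ x + e₀`. [folklore] -/
theorem adj_add_ev_zero {x : Site 3} (hx : Even (psum x)) : graph.Adj x (x + ev 0) := by
  have := adj_add_rung x; rwa [rung_of_even hx] at this

/-- On an odd vertex `x ∼ x − e₀`. [folklore] -/
theorem adj_sub_ev_zero {x : Site 3} (hx : ¬ Even (psum x)) : graph.Adj x (x - ev 0) := by
  have := adj_add_rung x; rwa [rung_of_not_even hx, ← sub_eq_add_neg] at this

/-- **Adjacency, spelled out**: the five neighbours of `x` are `x ± e₁`, `x ± e₂` and `x + rung x`. [folklore] -/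
theorem graph_adj_iff' (x y : Site 3) :
    graph.Adj x y ↔ y = x + ev 1 ∨ y = x - ev 1 ∨ y = x + ev 2 ∨ y = x - ev 2 ∨ y = x + rung x := by
  rw [graph_adj_iff, mem_stepsAt_iff, sub_eq_iff_eq_add', sub_eq_iff_eq_add', sub_eq_iff_eq_add', sub_eq_iff_eq_add', sub_eq_iff_eq_add',
    ← sub_eq_add_neg, ← sub_eq_add_neg]

/-- The neighbour set of `x` is the image of `stepsAt x`. [folklore] -/
theorem neighborSet_eq (x : Site 3) : graph.neighborSet x = ↑((stepsAt x).image (x + ·)) := by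
  ext y
  rw [SimpleGraph.mem_neighborSet, graph_adj_iff, Finset.coe_image, Set.mem_image]
  constructor
  · intro h; exact ⟨y - x, h, by abel⟩
  · rintro ⟨s, hs, rfl⟩; simpa using hs

/-- The graph is locally finite. [folklore] -/
instance graph_locallyFinite : graph.LocallyFinite := fun x =>
  (((stepsAt x).image (x + ·)).finite_toSet.subset (neighborSet_eq x).le).fintype

/-- Induced subgraphs are locally finite. [folklore] -/
instance graph_induce_locallyFinite (s : Set (Site 3)) : (graph.induce s).LocallyFinite := fun x =>
  (((graph.neighborSet x.1).toFinite.preimage Subtype.val_injective.injOn).subset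
    fun y (hy : (graph.induce s).Adj x y) => by simpa [SimpleGraph.mem_neighborSet] using hy).fintype

/-- **Degree `≤ 5`** (in fact `= 5`). [folklore] -/
theorem graph_degree_le (x : Site 3) : graph.degree x ≤ 5 := by
  have h : graph.neighborFinset x = (stepsAt x).image (x + ·) := by
    apply Finset.coe_injective; rw [SimpleGraph.coe_neighborFinset, neighborSet_eq]
  rw [← SimpleGraph.card_neighborFinset_eq_degree, h]
  refine Finset.card_image_le.trans ?_
  rw [stepsAt]
  refine (Finset.card_insert_le _ _).trans (Nat.succ_le_succ ((Finset.card_insert_le _ _).trans (Nat.succ_le_succ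
    ((Finset.card_insert_le _ _).trans (Nat.succ_le_succ ((Finset.card_insert_le _ _).trans (Nat.succ_le_succ (Finset.card_singleton _).le)))))))

/-! ## §2 Automorphisms -/

/-- An automorphism from a pair of mutually inverse adjacency-preserving self-maps. [folklore] -/
def isoOfMaps (σ τ : Site 3 → Site 3) (h₁ : Function.LeftInverse τ σ) (h₂ : Function.RightInverse τ σ)
    (hσ : ∀ x y, graph.Adj x y → graph.Adj (σ x) (σ y)) (hτ : ∀ x y, graph.Adj x y → graph.Adj (τ x) (τ y)) : graph ≃g graph where
  toEquiv := ⟨σ, τ, h₁, h₂⟩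
  map_rel_iff' := by
    intro x y
    change graph.Adj (σ x) (σ y) ↔ graph.Adj x y
    constructor
    · intro h
      have h' : graph.Adj (τ (σ x)) (τ (σ y)) := hτ _ _ h
      rwa [h₁ x, h₁ y] at h'
    · exact hσ x y

/-- `isoOfMaps` acts by `σ`. [folklore] -/
@[simp] theorem isoOfMaps_apply (σ τ : Site 3 → Site 3) (h₁ h₂ hσ hτ) (x : Site 3) : isoOfMaps σ τ h₁ h₂ hσ hτ x = σ x := rfl

/-- A translation by a vector of EVEN coordinate sum preserves adjacency. [folklore] -/
theorem adj_add_right {v : Site 3} (hv : Even (psum v)) {x y : Site 3} (h : graph.Adj x y) : graph.Adj (x + v) (y + v) := by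
  rw [graph_adj_iff] at h ⊢
  rw [add_sub_add_right_eq_sub, stepsAt_congr (show Even (psum (x + v)) ↔ Even (psum x) by rw [psum_add, Int.even_add]; tauto)]
  exact h

/-- **Translation by `v` with `v₀ + v₁ + v₂` even** is an automorphism. [cite: BenjaminiSchramm1996, §2] -/
def shift (v : Site 3) (hv : Even (psum v)) : graph ≃g graph :=
  isoOfMaps (· + v) (· + -v) (fun x => by simp) (fun x => by simp) (fun _ _ h => adj_add_right hv h)
    (fun _ _ h => adj_add_right (by rwa [psum_neg, even_neg]) h)

/-- `shift v hv x = x + v`. [folklore] -/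
@[simp] theorem shift_apply (v : Site 3) (hv : Even (psum v)) (x : Site 3) : shift v hv x = x + v := rfl

/-- The parity-swapping reflection `(x₀, x₁, x₂) ↦ (−1 − x₀, x₁, x₂)` (an involution). [folklore] -/
def swapFun (x : Site 3) : Site 3 := ![-1 - x 0, x 1, x 2]

/-- Coordinates of the reflection. [folklore] -/
@[simp] theorem swapFun_apply_zero (x : Site 3) : swapFun x 0 = -1 - x 0 := rfl
/-- Coordinates of the reflection. [folklore] -/
@[simp] theorem swapFun_apply_one (x : Site 3) : swapFun x 1 = x 1 := rfl
/-- Coordinates of the reflection. [folklore] -/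
@[simp] theorem swapFun_apply_two (x : Site 3) : swapFun x 2 = x 2 := rfl

/-- The reflection is an involution. [folklore] -/
theorem swapFun_involutive : Function.Involutive swapFun := by
  intro x; ext i; fin_cases i <;> simp

/-- The reflection swaps the parity of `psum`. [folklore] -/
theorem even_psum_swapFun (x : Site 3) : Even (psum (swapFun x)) ↔ ¬ Even (psum x) := by
  have e : psum (swapFun x) = psum x - 2 * x 0 - 1 := by simp [psum]; ring
  rw [e, Int.even_sub_one, Int.even_sub]
  simp

/-- The reflection reverses the rung: `rung (swapFun x) = −rung x`. [folklore] -/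
theorem rung_swapFun (x : Site 3) : rung (swapFun x) = -rung x := by
  by_cases hx : Even (psum x)
  · rw [rung_of_even hx, rung_of_not_even ((even_psum_swapFun x).not.2 (not_not.2 hx))]
  · rw [rung_of_not_even hx, rung_of_even ((even_psum_swapFun x).2 hx), neg_neg]

/-- The reflection preserves adjacency. [folklore] -/
theorem adj_swapFun {x y : Site 3} (h : graph.Adj x y) : graph.Adj (swapFun x) (swapFun y) := by
  rw [graph_adj_iff'] at h ⊢
  rw [rung_swapFun]
  rcases h with rfl | rfl | rfl | rfl | rfl
  · left; ext i; fin_cases i <;> simp [ev]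
  · right; left; ext i; fin_cases i <;> simp [ev]
  · right; right; left; ext i; fin_cases i <;> simp [ev]
  · right; right; right; left; ext i; fin_cases i <;> simp [ev]
  · right; right; right; right
    by_cases hx : Even (psum x)
    · rw [rung_of_even hx]; ext i; fin_cases i <;> simp [ev]; ring
    · rw [rung_of_not_even hx]; ext i; fin_cases i <;> simp [ev]; ring

/-- **The parity-swapping reflection is an automorphism** (it exchanges the two checkerboard classes). [cite: BenjaminiSchramm1996, §2] -/
def swapIso : graph ≃g graph :=
  isoOfMaps swapFun swapFun swapFun_involutive swapFun_involutive (fun _ _ h => adj_swapFun h) (fun _ _ h => adj_swapFun h)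

/-- `swapIso x = (−1 − x₀, x₁, x₂)`. [folklore] -/
@[simp] theorem swapIso_apply (x : Site 3) : swapIso x = swapFun x := rfl

/-- The chart-reversing map `(x₀, x₁, x₂) ↦ (x₀, −x₁, −x₂)`. [folklore] -/
def negFun (x : Site 3) : Site 3 := ![x 0, -x 1, -x 2]

/-- Coordinates. [folklore] -/
@[simp] theorem negFun_apply_zero (x : Site 3) : negFun x 0 = x 0 := rfl
/-- Coordinates. [folklore] -/
@[simp] theorem negFun_apply_one (x : Site 3) : negFun x 1 = -x 1 := rfl
/-- Coordinates. [folklore] -/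
@[simp] theorem negFun_apply_two (x : Site 3) : negFun x 2 = -x 2 := rfl

/-- `negFun` keeps the parity of `psum` and hence the rung. [folklore] -/
theorem rung_negFun (x : Site 3) : rung (negFun x) = rung x :=
  rung_congr (by
    have e : psum (negFun x) = psum x - 2 * (x 1 + x 2) := by simp [psum]; ring
    rw [e, Int.even_sub]; simp)

/-- `negFun` preserves adjacency. [folklore] -/
theorem adj_negFun {x y : Site 3} (h : graph.Adj x y) : graph.Adj (negFun x) (negFun y) := by
  rw [graph_adj_iff'] at h ⊢
  rw [rung_negFun]
  rcases h with rfl | rfl | rfl | rfl | rfl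
  · right; left; ext i; fin_cases i <;> simp [ev]; omega
  · left; ext i; fin_cases i <;> simp [ev]; omega
  · right; right; right; left; ext i; fin_cases i <;> simp [ev]; omega
  · right; right; left; ext i; fin_cases i <;> simp [ev]; omega
  · right; right; right; right
    by_cases hx : Even (psum x)
    · rw [rung_of_even hx]; ext i; fin_cases i <;> simp [ev]
    · rw [rung_of_not_even hx]; ext i; fin_cases i <;> simp [ev]

/-- **`(x₀, x₁, x₂) ↦ (x₀, −x₁, −x₂)` is an automorphism** (the central inversion of the chart of file II). [cite: KozmaNitzan2024, §4 Lemma 8 p. 16] -/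
def negIso : graph ≃g graph :=
  isoOfMaps negFun negFun (fun x => by ext i; fin_cases i <;> simp) (fun x => by ext i; fin_cases i <;> simp)
    (fun _ _ h => adj_negFun h) (fun _ _ h => adj_negFun h)

/-- `negIso x = (x₀, −x₁, −x₂)`. [folklore] -/
@[simp] theorem negIso_apply (x : Site 3) : negIso x = negFun x := rfl

/-- The vertical flip `(x₀, x₁, x₂) ↦ (x₀, x₁, −x₂)`. [folklore] -/
def flipZFun (x : Site 3) : Site 3 := ![x 0, x 1, -x 2]

/-- Coordinates. [folklore] -/
@[simp] theorem flipZFun_apply_zero (x : Site 3) : flipZFun x 0 = x 0 := rfl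
/-- Coordinates. [folklore] -/
@[simp] theorem flipZFun_apply_one (x : Site 3) : flipZFun x 1 = x 1 := rfl
/-- Coordinates. [folklore] -/
@[simp] theorem flipZFun_apply_two (x : Site 3) : flipZFun x 2 = -x 2 := rfl

/-- The vertical flip keeps the rung. [folklore] -/
theorem rung_flipZFun (x : Site 3) : rung (flipZFun x) = rung x :=
  rung_congr (by
    have e : psum (flipZFun x) = psum x - 2 * x 2 := by simp [psum]; ring
    rw [e, Int.even_sub]; simp)

/-- The vertical flip preserves adjacency. [folklore] -/
theorem adj_flipZFun {x y : Site 3} (h : graph.Adj x y) : graph.Adj (flipZFun x) (flipZFun y) := by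
  rw [graph_adj_iff'] at h ⊢
  rw [rung_flipZFun]
  rcases h with rfl | rfl | rfl | rfl | rfl
  · left; ext i; fin_cases i <;> simp [ev]
  · right; left; ext i; fin_cases i <;> simp [ev]
  · right; right; right; left; ext i; fin_cases i <;> simp [ev]; omega
  · right; right; left; ext i; fin_cases i <;> simp [ev]; omega
  · right; right; right; right
    by_cases hx : Even (psum x)
    · rw [rung_of_even hx]; ext i; fin_cases i <;> simp [ev]
    · rw [rung_of_not_even hx]; ext i; fin_cases i <;> simp [ev]

/-- **The vertical flip is an automorphism** (the axis flip of the chart of file II). [cite: KozmaNitzan2024, §4 Lemma 8 p. 16] -/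
def flipZIso : graph ≃g graph :=
  isoOfMaps flipZFun flipZFun (fun x => by ext i; fin_cases i <;> simp) (fun x => by ext i; fin_cases i <;> simp)
    (fun _ _ h => adj_flipZFun h) (fun _ _ h => adj_flipZFun h)

/-- `flipZIso x = (x₀, x₁, −x₂)`. [folklore] -/
@[simp] theorem flipZIso_apply (x : Site 3) : flipZIso x = flipZFun x := rfl

/-! ## §3 Transitivity -/

/-- **Every vertex is the image of `0` under an automorphism**: an even translation, or the reflection followed by an even translation. [folklore] -/
theorem exists_iso_apply_zero (v : Site 3) : ∃ γ : graph ≃g graph, γ 0 = v := by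
  by_cases hv : Even (psum v)
  · exact ⟨shift v hv, by simp⟩
  · have hv' : Even (psum (v + ev 0)) := by rw [psum_add, psum_ev, Int.even_add_one]; exact hv
    refine ⟨swapIso.trans (shift (v + ev 0) hv'), ?_⟩
    rw [RelIso.trans_apply, swapIso_apply, shift_apply]
    ext i; fin_cases i <;> simp [ev]

/-- **The alternating-rung net is vertex-transitive.** [cite: BenjaminiSchramm1996, §2] -/
theorem graph_transitive : IsGraphTransitive graph := fun x y => by
  obtain ⟨γx, hx⟩ := exists_iso_apply_zero x
  obtain ⟨γy, hy⟩ := exists_iso_apply_zero y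
  refine ⟨γx.symm.trans γy, ?_⟩
  rw [RelIso.trans_apply, ← hx, RelIso.symm_apply_apply, hy]

/-- … hence quasi-transitive. [folklore] -/
theorem graph_quasiTransitive : IsQuasiTransitive graph := by
  refine ⟨{0}, fun v => ?_⟩
  obtain ⟨γ, hγ⟩ := graph_transitive v 0
  exact ⟨γ, by simp [hγ]⟩

end Sqp

end Summit.CriticalPhenomena.PercolationContinuityZ3.Theorems.Transplant

end
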